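import Summits.CriticalPhenomena.SAWScalingLimit.Theorems.SAWDevelopingMapHexTightBoundaryOnFrontier
import Literature.Probability.RandomPlanarGeometry.ShellTraversalNet
import Literature.Probability.RandomPlanarGeometry.CurveTraversalCompact
import HarnessLib

/-!
# `HexTight` IS per-shell tightness on the interior and on the Jordan curve (stmt-CriticalPhenomena-5423)

Crux `Summit.CriticalPhenomena.SAWScalingLimit.Theses.SAWDevelopingMap.HexTight`, line `reversal-virgin-disc`, seat c2
(`prover-line-stmt-CriticalPhenomena-5423-c2-0`). The CONVERSE of the reductions of
`SAWDevelopingMapHexTightBoundaryReduction.lean` (seat c1) and `SAWDevelopingMapHexTightBoundaryOnFrontier.lean` (seat c2),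
ported from the refuter's probe `Cruxes/HexTight/DrefutePerShellTight.lean: hexTraversalBound_of_crux` (drefute, not
importable from `Theorems/`) in its shortest form: tightness along the mesh ⇒ for each tolerance ONE compact set of
curve classes eventually carries all but `η` of the mass (`IsTightAlongMesh`), and a compact set of curve classes
traverses a genuine shell boundedly often (`CurveClass.exists_not_hasTraversals_of_isCompact`, Literature). Hence

* `perShellTight_of_hexTight` — the crux implies per-shell, rate-free tightness of the traversal number on EVERY
  genuine shell `D(x; ρ, R)`, `ρ < R` (no thinness, no position condition), for every Dobrushin domain and endpoint
  approximation;
* `interiorPerShellTight_of_deepBound_one`, `interiorPerShellTight_of_deepPerShellTight` — the interior regime is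
  only needed DEEP inside: for any depth factor `dep ≥ 1`, a rate (exponent `> 1`) resp. per-shell tightness on the
  shells with `closedBall x (dep · R) ⊆ Ω` gives per-shell tightness on all thin interior shells (net localization with
  the small shells' outer radius divided by `dep`).
* `hexTight_iff_deepInterior_and_onFrontier`, `hexTight_iff_interiorThin_and_onFrontier` — **the crux is EQUIVALENT
  to the conjunction of two local per-shell atoms**: per-shell tightness on deep (resp. all) thin interior shells and
  on thin shells centred on the Jordan curve (`x ∈ frontier Ω`). Neither atom is a strengthening of the crux.

References: M. Aizenman, A. Burchard, Duke Math. J. 99 (1999) §1–§2 [AizenmanBurchardDuke1999];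
H. Duminil-Copin, S. Smirnov, Ann. of Math. 175 (2012) §4 [DuminilCopinSmirnov2012].
-/

noncomputable section

open scoped BigOperators Classical ENNReal
open MeasureTheory Filter Topology Set Metric
open Literature.Probability.LatticeModels Literature.Probability.RandomPlanarGeometry
  Literature.Probability.RandomPlanarGeometry.SAW

namespace Summit.CriticalPhenomena.SAWScalingLimit.Theorems.HexTight.BoundaryOnFrontier

open Summit.CriticalPhenomena.SAWScalingLimit.Theorems.HexTight.ExponentBootstrap

/-- **The crux implies per-shell tightness of the traversal number on every genuine shell.** If the critical
hexagonal SAW laws of `(D; a, b)` are tight along the mesh, then for every shell `D(x; ρ, R)` with `ρ < R` and every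
`η > 0` there are a threshold `k` and a mesh bound `δ₁ > 0` such that for all `δ ∈ (0, δ₁]` the SAW polyline makes `k`
separate traversals of the shell with probability `≤ η` (tightness ⇒ one compact set ⇒ bounded traversal count). -/
theorem perShellTight_of_hexTight :
    Summit.CriticalPhenomena.SAWScalingLimit.Theses.SAWDevelopingMap.HexTight →
      ∀ (D : DobrushinDomain) (a b : ℝ → HexVertex), IsEmbEndpointApprox hexGraph hexCenter D a b →
        ∀ (x : ℂ) (ρ R : ℝ), ρ < R → ∀ (η : ℝ), 0 < η →
          ∃ (k : ℕ) (δ₁ : ℝ), 0 < δ₁ ∧ ∀ δ ∈ Set.Ioc (0 : ℝ) δ₁,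
            hexSAWLaw D.carrier δ (a δ) (b δ)
              {γ | (⟨γ.walk.toCurve fun v => (δ : ℂ) * hexCenter v⟩ : Curve ℂ).HasTraversals k x ρ R} ≤
              ENNReal.ofReal η := by
  intro h D a b hab x ρ R hρR η hη
  obtain ⟨K, hK, hev⟩ := h D a b hab (ENNReal.ofReal η) (ENNReal.ofReal_pos.2 hη)
  obtain ⟨k, hk⟩ := CurveClass.exists_not_hasTraversals_of_isCompact hK x hρR
  obtain ⟨δ₁, hδ₁, hsub⟩ := mem_nhdsGT_iff_exists_Ioo_subset.1 hev
  have hδ₁pos : 0 < δ₁ := hδ₁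
  refine ⟨k, δ₁ / 2, half_pos hδ₁pos, fun δ hδ => ?_⟩
  have hδ' : δ ∈ Set.Ioo 0 δ₁ := ⟨hδ.1, by linarith [hδ.2]⟩
  have hbd := hsub hδ'
  simp only [Set.mem_setOf_eq] at hbd
  refine le_trans (measure_mono fun γ hγ => ?_) hbd
  intro hγK
  exact hk ⟨γ.walk.toCurve fun v => (δ : ℂ) * hexCenter v⟩ hγK hγ

/-! ### The interior atom lives DEEP inside: rates are only needed at depth `dep · R` -/

/-- **Interior traversal bound on DEEP shells ⇒ thin-interior per-shell tightness.** For any depth factor `dep ≥ 1`: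
a traversal bound with some exponent `> 1` on the shells `D(x; ρ, R)` with `closedBall x (dep · R) ⊆ Ω` gives per-shell
tightness of the traversal number on EVERY thin interior shell (`4ρ < R ≤ 1`, `closedBall x R ⊆ Ω`): in the net
localization of `ExponentBootstrap.interiorPerShellTight_of_interiorBound_one` the small shells about the net points
`c_j` of the middle circle may be given the outer radius `h' = (hh - w)/dep` (`Curve.HasTraversals.mono'`), and then
`closedBall c_j (dep · h') = closedBall c_j (hh - w) ⊆ closedBall x R ⊆ Ω`; the union bound is
`M · K (dep · C₀/M)^λ → 0`. -/
theorem interiorPerShellTight_of_deepBound_one (dep : ℝ) (hdep : 1 ≤ dep) :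
    ∀ (Ω : Set ℂ) (a b : ℝ → HexVertex),
      (∃ (k : ℂ → ℝ → ℝ → ℕ) (K lam δ₀ : ℝ), 0 ≤ K ∧ 1 < lam ∧ 0 < δ₀ ∧
        ∀ δ ∈ Set.Ioc (0 : ℝ) δ₀, ∀ (x : ℂ) (ρ R : ℝ), δ ≤ ρ → ρ < R → R ≤ 1 →
          Metric.closedBall x (dep * R) ⊆ Ω →
          hexSAWLaw Ω δ (a δ) (b δ)
            {γ | (⟨γ.walk.toCurve fun v => (δ : ℂ) * hexCenter v⟩ : Curve ℂ).HasTraversals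
              (k x ρ R) x ρ R} ≤ ENNReal.ofReal (K * (ρ / R) ^ lam)) →
      ∀ (x : ℂ) (ρ R : ℝ), 0 < ρ → 4 * ρ < R → R ≤ 1 → Metric.closedBall x R ⊆ Ω → ∀ η : ℝ, 0 < η →
        ∃ (k' : ℕ) (δ₁ : ℝ), 0 < δ₁ ∧ ∀ δ ∈ Set.Ioc (0 : ℝ) δ₁, δ ≤ ρ →
          hexSAWLaw Ω δ (a δ) (b δ)
            {γ | (⟨γ.walk.toCurve fun v => (δ : ℂ) * hexCenter v⟩ : Curve ℂ).HasTraversals k' x ρ R} ≤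
            ENNReal.ofReal η := by
  intro Ω a b hI
  obtain ⟨k, K, lam, δ₀, hK, hlam, hδ₀, h⟩ := hI
  intro x ρ R hρ h4 hR1 hin η hη
  have hρR : ρ < R := by linarith
  have hdep0 : 0 < dep := by linarith
  -- middle radius `m`, half width `hh`
  obtain ⟨m, hm⟩ : ∃ m : ℝ, m = (ρ + R) / 2 := ⟨_, rfl⟩
  obtain ⟨hh, hhh⟩ : ∃ hh : ℝ, hh = (R - ρ) / 2 := ⟨_, rfl⟩
  have hmpos : 0 < m := by rw [hm]; linarith
  have hhpos : 0 < hh := by rw [hhh]; linarith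
  have hmR : m + hh = R := by rw [hm, hhh]; ring
  have hhR : hh ≤ R := by linarith
  -- the union-bound constant and the net size
  obtain ⟨C₀, hC₀⟩ : ∃ C₀ : ℝ, C₀ = 4 * Real.pi * m / hh := ⟨_, rfl⟩
  have hC₀pos : 0 < C₀ := by rw [hC₀]; positivity
  have hdC₀ : 0 ≤ dep * C₀ := by positivity
  obtain ⟨M₀, hM₀⟩ := Filter.eventually_atTop.1
    ((tendsto_unionBound (K := K) hdC₀ hlam).eventually (Iio_mem_nhds hη))
  obtain ⟨M, hMdef⟩ : ∃ M : ℕ, M = max M₀ (⌈(dep + 1) * C₀⌉₊ + 1) := ⟨_, rfl⟩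
  have hMM₀ : M₀ ≤ M := hMdef ▸ le_max_left _ _
  have hMC : (dep + 1) * C₀ < M := by
    have h1 : ((⌈(dep + 1) * C₀⌉₊ + 1 : ℕ) : ℝ) ≤ M := by rw [hMdef]; exact_mod_cast le_max_right _ _
    have h2 : (dep + 1) * C₀ < ((⌈(dep + 1) * C₀⌉₊ + 1 : ℕ) : ℝ) := by
      push_cast; linarith [Nat.le_ceil ((dep + 1) * C₀)]
    linarith
  have hMC' : C₀ < M := by nlinarith
  have hMpos : (0 : ℝ) < M := hC₀pos.trans hMC'
  have hM1 : 1 ≤ M := by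
    rw [hMdef]; exact le_max_of_le_right (Nat.succ_le_succ (Nat.zero_le _))
  have hsmall : (M : ℝ) * (K * (dep * C₀ / M) ^ lam) < η := hM₀ M hMM₀
  -- radii of the small shells
  obtain ⟨w, hw⟩ : ∃ w : ℝ, w = 2 * Real.pi * ((ρ + R) / 2) / M := ⟨_, rfl⟩
  have hw' : w = C₀ * hh / (2 * M) := by
    rw [hw, hC₀, ← hm]; field_simp; ring
  have hwpos : 0 < w := by rw [hw']; positivity
  have hdw : (dep + 1) * w < hh := by
    rw [hw', show C₀ * hh / (2 * M) = (C₀ / M) * hh / 2 by field_simp]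
    have h1 : (dep + 1) * (C₀ / M) < 1 := by
      rw [← mul_div_assoc, div_lt_one hMpos]; exact hMC
    nlinarith
  have h2w : 2 * w < hh := by nlinarith
  have hratio : w / (hh - w) ≤ C₀ / M := by
    have hden : hh / 2 ≤ hh - w := by linarith
    calc w / (hh - w) ≤ w / (hh / 2) := div_le_div_of_nonneg_left hwpos.le (by positivity) hden
      _ = C₀ / M := by rw [hw']; field_simp
  -- outer radius of the small DEEP shells
  obtain ⟨h', hh'⟩ : ∃ h' : ℝ, h' = (hh - w) / dep := ⟨_, rfl⟩
  have hh'pos : 0 < h' := by rw [hh']; exact div_pos (by linarith) hdep0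
  have hwh' : w < h' := by
    rw [hh', lt_div_iff₀ hdep0]; nlinarith
  have hh'le : h' ≤ hh - w := by
    rw [hh', div_le_iff₀ hdep0]; nlinarith
  have hdeph' : dep * h' = hh - w := by rw [hh']; field_simp
  have hratio' : w / h' ≤ dep * C₀ / M := by
    have : w / h' = dep * (w / (hh - w)) := by rw [hh']; field_simp
    rw [this, mul_div_assoc]
    exact mul_le_mul_of_nonneg_left hratio hdep0.le
  -- net centres; they are at distance `m` from `x`, so the small shells are deep
  obtain ⟨c, hc⟩ : ∃ c : ℕ → ℂ, c = fun j : ℕ => x + (((ρ + R) / 2 : ℝ) : ℂ) *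
      Complex.exp (((-Real.pi + 2 * Real.pi * (j : ℝ) / M : ℝ) : ℂ) * Complex.I) := ⟨_, rfl⟩
  have hcdist : ∀ j : ℕ, dist (c j) x = m := by
    intro j
    rw [hc]
    simp only [dist_eq_norm, add_sub_cancel_left, norm_mul, Complex.norm_real, Complex.norm_exp_ofReal_mul_I,
      mul_one, Real.norm_eq_abs, ← hm]
    exact abs_of_pos hmpos
  have hcin : ∀ j : ℕ, Metric.closedBall (c j) (dep * h') ⊆ Ω := by
    intro j y hy
    refine hin ?_
    rw [Metric.mem_closedBall] at hy ⊢
    calc dist y x ≤ dist y (c j) + dist (c j) x := dist_triangle _ _ _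
      _ ≤ (hh - w) + m := by rw [hcdist, ← hdeph']; linarith
      _ ≤ R := by linarith
  refine ⟨∑ j ∈ Finset.range M, k (c j) w h', min w δ₀, lt_min hwpos hδ₀, fun δ hδ _ => ?_⟩
  have hfine : δ ≤ w := hδ.2.trans (min_le_left _ _)
  have hδ' : δ ∈ Set.Ioc (0 : ℝ) δ₀ := ⟨hδ.1, hδ.2.trans (min_le_right _ _)⟩
  have hsub : {γ : HexDomainSAW Ω δ (a δ) (b δ) |
      (⟨γ.walk.toCurve fun v => (δ : ℂ) * hexCenter v⟩ : Curve ℂ).HasTraversals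
        (∑ j ∈ Finset.range M, k (c j) w h') x ρ R} ⊆
      ⋃ j ∈ Finset.range M, {γ | (⟨γ.walk.toCurve fun v => (δ : ℂ) * hexCenter v⟩ : Curve ℂ).HasTraversals
        (k (c j) w h') (c j) w h'} := by
    intro γ hγ
    obtain ⟨j, hj, hjT⟩ := Curve.exists_net_hasTraversals_of_hasTraversals hρ.le hρR hM1
      (fun j => k (c j) w h') hγ
    refine Set.mem_iUnion₂.2 ⟨j, Finset.mem_range.2 hj, ?_⟩
    have e1 : (R - ρ) / 2 - w = hh - w := by rw [hhh]
    rw [← hw] at hjT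
    rw [e1] at hjT
    have hjT' := hjT.mono' le_rfl hh'le
    simpa only [hc, Set.mem_setOf_eq] using hjT'
  have hper : ∀ j ∈ Finset.range M,
      hexSAWLaw Ω δ (a δ) (b δ) {γ | (⟨γ.walk.toCurve fun v => (δ : ℂ) * hexCenter v⟩ : Curve ℂ).HasTraversals
        (k (c j) w h') (c j) w h'} ≤ ENNReal.ofReal (K * (dep * C₀ / M) ^ lam) := by
    intro j _
    refine (h δ hδ' (c j) w h' hfine hwh' (by linarith) (hcin j)).trans
      (ENNReal.ofReal_le_ofReal (mul_le_mul_of_nonneg_left ?_ hK))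
    exact Real.rpow_le_rpow (div_nonneg hwpos.le hh'pos.le) hratio' (by linarith)
  calc hexSAWLaw Ω δ (a δ) (b δ) _
      ≤ hexSAWLaw Ω δ (a δ) (b δ) (⋃ j ∈ Finset.range M, {γ |
          (⟨γ.walk.toCurve fun v => (δ : ℂ) * hexCenter v⟩ : Curve ℂ).HasTraversals
            (k (c j) w h') (c j) w h'}) := measure_mono hsub
    _ ≤ ∑ j ∈ Finset.range M, hexSAWLaw Ω δ (a δ) (b δ) {γ |
          (⟨γ.walk.toCurve fun v => (δ : ℂ) * hexCenter v⟩ : Curve ℂ).HasTraversals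
            (k (c j) w h') (c j) w h'} := measure_biUnion_finset_le _ _
    _ ≤ ∑ j ∈ Finset.range M, ENNReal.ofReal (K * (dep * C₀ / M) ^ lam) := Finset.sum_le_sum hper
    _ = ENNReal.ofReal ((M : ℝ) * (K * (dep * C₀ / M) ^ lam)) := by
        rw [Finset.sum_const, Finset.card_range, nsmul_eq_mul, ← ENNReal.ofReal_natCast M,
          ← ENNReal.ofReal_mul (Nat.cast_nonneg M)]
    _ ≤ ENNReal.ofReal η := ENNReal.ofReal_le_ofReal hsmall.le

/-- **Per-shell tightness on DEEP thin shells ⇒ per-shell tightness on all thin interior shells** (depth factor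
`dep ≥ 1`): per-shell tightness on the shells with `4ρ < R ≤ 1`, `closedBall x (dep · R) ⊆ Ω` gives the rate `λ = 3`
on that class (`ExponentBootstrap.shellBound_of_perShellTight_thin 4`, all meshes `0 < δ ≤ ρ`), which feeds
`interiorPerShellTight_of_deepBound_one`. -/
theorem interiorPerShellTight_of_deepPerShellTight (dep : ℝ) (hdep : 1 ≤ dep) (Ω : Set ℂ) (a b : ℝ → HexVertex)
    (hD : ∀ (x : ℂ) (ρ R : ℝ), 0 < ρ → 4 * ρ < R → R ≤ 1 → Metric.closedBall x (dep * R) ⊆ Ω → ∀ η : ℝ, 0 < η →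
      ∃ (k : ℕ) (δ₁ : ℝ), 0 < δ₁ ∧ ∀ δ ∈ Set.Ioc (0 : ℝ) δ₁, δ ≤ ρ →
        hexSAWLaw Ω δ (a δ) (b δ)
          {γ | (⟨γ.walk.toCurve fun v => (δ : ℂ) * hexCenter v⟩ : Curve ℂ).HasTraversals k x ρ R} ≤
          ENNReal.ofReal η) :
    ∀ (x : ℂ) (ρ R : ℝ), 0 < ρ → 4 * ρ < R → R ≤ 1 → Metric.closedBall x R ⊆ Ω → ∀ η : ℝ, 0 < η →
      ∃ (k' : ℕ) (δ₁ : ℝ), 0 < δ₁ ∧ ∀ δ ∈ Set.Ioc (0 : ℝ) δ₁, δ ≤ ρ →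
        hexSAWLaw Ω δ (a δ) (b δ)
          {γ | (⟨γ.walk.toCurve fun v => (δ : ℂ) * hexCenter v⟩ : Curve ℂ).HasTraversals k' x ρ R} ≤
          ENNReal.ofReal η := by
  obtain ⟨k', hk'⟩ := shellBound_of_perShellTight_thin 4 le_rfl (fun x R => Metric.closedBall x (dep * R) ⊆ Ω)
    Ω a b (fun x ρ R hρ hρR hR1 hg η hη => hD x ρ R hρ hρR hR1 hg η hη) 3 (by norm_num)
  refine interiorPerShellTight_of_deepBound_one dep hdep Ω a b
    ⟨k', (4 : ℝ) ^ (3 : ℝ), 3, 1, by positivity, by norm_num, one_pos, fun δ hδ x ρ R hδρ hρR hR1 hg => ?_⟩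
  exact hk' δ x ρ R hδ.1 hδρ hρR hR1 hg


/-- **`HexTight` ⟺ (DEEP-interior per-shell tightness) ∧ (on-the-Jordan-curve per-shell tightness)**, for any depth
factor `dep ≥ 1`: the crux is equivalent to per-shell, rate-free tightness of the traversal number on (i) the thin shells
lying at depth `dep` inside the domain (`4ρ < R ≤ 1`, `closedBall x (dep · R) ⊆ Ω`) and (ii) the thin shells centred
on the Jordan curve (`4ρ < R ≤ 1`, `x ∈ frontier Ω`). This is the final shape of what the crux asks of the critical
SAW: no rate, no uniformity, two local regimes. -/
theorem hexTight_iff_deepInterior_and_onFrontier (dep : ℝ) (hdep : 1 ≤ dep) :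
    Summit.CriticalPhenomena.SAWScalingLimit.Theses.SAWDevelopingMap.HexTight ↔
    ((∀ (D : DobrushinDomain) (a b : ℝ → HexVertex), IsEmbEndpointApprox hexGraph hexCenter D a b →
      ∀ (x : ℂ) (ρ R : ℝ), 0 < ρ → 4 * ρ < R → R ≤ 1 → Metric.closedBall x (dep * R) ⊆ D.carrier →
        ∀ η : ℝ, 0 < η → ∃ (k : ℕ) (δ₁ : ℝ), 0 < δ₁ ∧ ∀ δ ∈ Set.Ioc (0 : ℝ) δ₁, δ ≤ ρ →
          hexSAWLaw D.carrier δ (a δ) (b δ)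
            {γ | (⟨γ.walk.toCurve fun v => (δ : ℂ) * hexCenter v⟩ : Curve ℂ).HasTraversals k x ρ R} ≤
            ENNReal.ofReal η) ∧
     (∀ (D : DobrushinDomain) (a b : ℝ → HexVertex), IsEmbEndpointApprox hexGraph hexCenter D a b →
      ∀ (x : ℂ) (ρ R : ℝ), 0 < ρ → 4 * ρ < R → R ≤ 1 → x ∈ frontier D.carrier → ∀ η : ℝ, 0 < η →
        ∃ (k : ℕ) (δ₁ : ℝ), 0 < δ₁ ∧ ∀ δ ∈ Set.Ioc (0 : ℝ) δ₁, δ ≤ ρ →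
          hexSAWLaw D.carrier δ (a δ) (b δ)
            {γ | (⟨γ.walk.toCurve fun v => (δ : ℂ) * hexCenter v⟩ : Curve ℂ).HasTraversals k x ρ R} ≤
            ENNReal.ofReal η)) := by
  constructor
  · intro h
    refine ⟨fun D a b hab x ρ R hρ0 h4 _ _ η hη => ?_, fun D a b hab x ρ R hρ0 h4 _ _ η hη => ?_⟩
    · obtain ⟨k, δ₁, hδ₁, hk⟩ := perShellTight_of_hexTight h D a b hab x ρ R (by linarith) η hη
      exact ⟨k, δ₁, hδ₁, fun δ hδ _ => hk δ hδ⟩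
    · obtain ⟨k, δ₁, hδ₁, hk⟩ := perShellTight_of_hexTight h D a b hab x ρ R (by linarith) η hη
      exact ⟨k, δ₁, hδ₁, fun δ hδ _ => hk δ hδ⟩
  · rintro ⟨hDp, hF⟩
    exact hexTight_of_interiorThin_of_onFrontier
      (fun D a b hab => interiorPerShellTight_of_deepPerShellTight dep hdep D.carrier a b (hDp D a b hab)) hF

/-- **`HexTight` ⟺ (thin-interior per-shell tightness) ∧ (on-the-Jordan-curve per-shell tightness).** The two
registered atoms of the line `reversal-virgin-disc` in per-shell form are jointly EQUIVALENT to the crux: `⇐` is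
`hexTight_of_interiorThin_of_onFrontier`, `⇒` is `perShellTight_of_hexTight` restricted to each class. -/
theorem hexTight_iff_interiorThin_and_onFrontier :
    Summit.CriticalPhenomena.SAWScalingLimit.Theses.SAWDevelopingMap.HexTight ↔
    ((∀ (D : DobrushinDomain) (a b : ℝ → HexVertex), IsEmbEndpointApprox hexGraph hexCenter D a b →
      ∀ (x : ℂ) (ρ R : ℝ), 0 < ρ → 4 * ρ < R → R ≤ 1 → Metric.closedBall x R ⊆ D.carrier → ∀ η : ℝ, 0 < η →
        ∃ (k : ℕ) (δ₁ : ℝ), 0 < δ₁ ∧ ∀ δ ∈ Set.Ioc (0 : ℝ) δ₁, δ ≤ ρ →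
          hexSAWLaw D.carrier δ (a δ) (b δ)
            {γ | (⟨γ.walk.toCurve fun v => (δ : ℂ) * hexCenter v⟩ : Curve ℂ).HasTraversals k x ρ R} ≤
            ENNReal.ofReal η) ∧
     (∀ (D : DobrushinDomain) (a b : ℝ → HexVertex), IsEmbEndpointApprox hexGraph hexCenter D a b →
      ∀ (x : ℂ) (ρ R : ℝ), 0 < ρ → 4 * ρ < R → R ≤ 1 → x ∈ frontier D.carrier → ∀ η : ℝ, 0 < η →
        ∃ (k : ℕ) (δ₁ : ℝ), 0 < δ₁ ∧ ∀ δ ∈ Set.Ioc (0 : ℝ) δ₁, δ ≤ ρ →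
          hexSAWLaw D.carrier δ (a δ) (b δ)
            {γ | (⟨γ.walk.toCurve fun v => (δ : ℂ) * hexCenter v⟩ : Curve ℂ).HasTraversals k x ρ R} ≤
            ENNReal.ofReal η)) := by
  constructor
  · intro h
    refine ⟨fun D a b hab x ρ R hρ0 h4 _ _ η hη => ?_, fun D a b hab x ρ R hρ0 h4 _ _ η hη => ?_⟩
    · obtain ⟨k, δ₁, hδ₁, hk⟩ := perShellTight_of_hexTight h D a b hab x ρ R (by linarith) η hη
      exact ⟨k, δ₁, hδ₁, fun δ hδ _ => hk δ hδ⟩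
    · obtain ⟨k, δ₁, hδ₁, hk⟩ := perShellTight_of_hexTight h D a b hab x ρ R (by linarith) η hη
      exact ⟨k, δ₁, hδ₁, fun δ hδ _ => hk δ hδ⟩
  · rintro ⟨hI, hF⟩
    exact hexTight_of_interiorThin_of_onFrontier hI hF

end Summit.CriticalPhenomena.SAWScalingLimit.Theorems.HexTight.BoundaryOnFrontier

end
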